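import Literature.Computability.QuantumComplexity.QuantumTuringADHGateSet
import Literature.Computability.QuantumComplexity.CircuitRealification
import HarnessLib

/-!
# The real Adleman–DeMarrais–Huang gate set: `BQP` by uniform circuits with entries in `{0, ±1, ±3/5, ±4/5}`

Corollary file of `QuantumTuringADHGateSet.lean` (the complex gate set
`adhGateSet = {R_θ, R_θ⁻¹, P_θ, P_θ⁻¹, CNOT}`, `cos θ = 3/5`, is placement-universal and
`BQPOver adhGateSet = BQP`) and `CircuitRealification.lean` (one extra wire turns every gate set into
a real one without changing acceptance probabilities or uniformity), for **quantum-advantage.S05**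
(`BQPQTMWith_adhAmplitudes : BQPQTMWith adhAmplitudes = BQPQTM`, Adleman–DeMarrais–Huang 1997,
Cor. 3.2 with Thm. 3.3(e)):

* **Exact compilers** (generic): a sound gate compiler whose words do not depend on the accuracy
  level implements every gate exactly, so substitution along it does not change acceptance
  probabilities at all and `BQPWith G₁ ε ⊆ BQPWith G₂ ε` for the SAME `ε`
  (`BQPWith_subset_BQPWith_of_exactCompiler`, from the `2⁻ᵗ`-bound of
  `abs_acceptProbOn_substFamily_sub_le` for every `t`); the case of gate-set renamings/embeddings.
* `adhRealGateSet = {R_θ, R_θ⁻¹, Λ(R_θ), Λ(R_θ⁻¹), CNOT}` — five REAL gates on `1, 1, 2, 2, 2` wires: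
  the real rotation and its inverse unchanged, the controlled rotations
  `Λ(R_θ^{±1}) = reOp P_θ^{±1}` (the realification `[[Re, -Im], [Im, Re]]` of the phase gate
  `diag(1, e^{±iθ})` IS the rotation of the flag wire controlled by the data wire), and `CNOT`;
  unitary, all gates on `≤ 2` wires, and **every entry is an Adleman–DeMarrais–Huang amplitude**
  (`adhRealGateSet_mat_mem_adhAmplitudes`: the entries are `0, 1, 3/5, ±4/5`);
* the exact compiler `adhLeanCompiler : realifyGateSet adhGateSet → adhRealGateSet` (drop the idle
  flag wire of the realified real gates `R_θ^{±1} ⊗ 1`, `CNOT ⊗ 1`; keep `reOp P_θ^{±1}`), whence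
  `BQPOver (realifyGateSet adhGateSet) ⊆ BQPOver adhRealGateSet` and, with
  `BQPOver adhGateSet = BQP` and realification, **`BQP_subset_BQPOver_adhRealGateSet`**:
  `BQP ⊆ BQPOver adhRealGateSet` — every `BQP` language is decided with error `≤ 1/3` by a
  polynomial-time uniform family of circuits all of whose gates are real matrices on at most two
  wires with entries in `{0, ±3/5, ±4/5, ±1}` (the circuit-model content of ADH's "rational real
  amplitudes suffice", Cor. 3.2 / Thm. 3.3(e), obtained from Solovay–Kitaev + realification instead
  of Lemma 3.5 + Feldman's bound); with `BQPQTM ⊆ BQP` also `BQPQTM ⊆ BQPOver adhRealGateSet`;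
* **`BQPQTM_subset_BQPQTMWith_adhAmplitudes_of_realExec`**: the missing inclusion
  `BQPQTM ⊆ BQPQTMWith adhAmplitudes` of S05 follows from the plain circuit-executor statement
  `BQPOver adhRealGateSet ⊆ BQPQTMWith adhAmplitudes` for this REAL gate set — a well-formed quantum
  Turing machine whose transition amplitudes are the gate entries themselves together with `0, ±1`
  (all in `adhAmplitudes`), running a polynomial-time uniform family at a fixed polynomial time
  (Nishimura–Ozawa 2002, Lemma 4.4 / Thm. 5.2; Bernstein–Vazirani 1997, §4 and §8). This is the
  instance `G = adhRealGateSet`, `S = adhAmplitudes` of the generic executor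
  "`BQPOver G ⊆ BQPQTMWith S` whenever the finite unitary gate set `G` (gates on `≤ 2` wires) has all
  entries in `S ∋ 0, ±1`", whose instance `G = cliffordT`, `S = C̃` is the remaining half
  `BQP ⊆ BQPQTM` of S04 (plan in the docstring of `BQPQTM_eq_BQP`, `QuantumTuring.lean`); no executor
  exists in the tree yet.

Everything is proved; no named facts are introduced.

## References

* L. M. Adleman, J. DeMarrais, M.-D. A. Huang, *Quantum computability*, SIAM J. Comput. 26 (1997)
  1524–1540 [AdlemanDeMarraisHuangSICOMP1997]: §2 (pp. 1525–1526), Thm. 3.1, Cor. 3.2, Thm. 3.3(e).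
* H. Nishimura, M. Ozawa, Theoret. Comput. Sci. 276 (2002) 147–181 [NishimuraOzawa2002], Lemma 4.4,
  Thm. 5.2.
* E. Bernstein, U. Vazirani, SIAM J. Comput. 26 (1997) 1411–1473 [BernsteinVazirani1997], §4, §8.
* M. A. Nielsen, I. L. Chuang, *Quantum Computation and Quantum Information*, CUP 2010, §4.5.3
  [NielsenChuang2010].
-/

noncomputable section

namespace Literature.Computability.QuantumComplexity

open _root_.Computability Complexity Matrix Complex Cryptography Lemma24

/-! ### Exact compilers move `BQP`-type classes without error -/

section Exact

variable {G₁ G₂ : QGateSet}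

/-- Along a compiler whose words do not depend on the accuracy level, substitution does not depend
on the level. [folklore] -/
theorem substCircuit_eq_of_levelFree (W : GateCompiler G₁ G₂) (hlev : ∀ k g, W.word k g = W.word 0 g)
    (k : ℕ) {N : ℕ} (C : QCircuit G₁ N) : substCircuit W k C = substCircuit W 0 C := by
  have h : substGate W k = (substGate W 0 : QGate G₁ N → List (QGate G₂ (N + W.scratch))) := by
    funext γ
    cases γ with
    | gate g e => simp only [substGate, hlev k g]
    | oracle q e => rfl
  simp only [substCircuit, h]

/-- Hence the substituted family does not depend on the level offset. [folklore] -/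
theorem substFamily_eq_of_levelFree (W : GateCompiler G₁ G₂) (hlev : ∀ k g, W.word k g = W.word 0 g)
    (t : ℕ) (F : QCircuitFamily G₁) : substFamily W t F = substFamily W 0 F := by
  unfold substFamily
  simp only [substCircuit_eq_of_levelFree W hlev]

variable [Encodable G₁.Op] [Encodable G₂.Op]

/-- **Exact compilation does not change `BQP`-type classes at all.** If `W` is a sound compiler
between unitary gate sets along which substituted families stay uniform and whose words do not
depend on the accuracy level (so each word implements its gate EXACTLY up to a phase: the error
`2⁻ᵏ` holds for every `k`), then `BQPWith G₁ ε ⊆ BQPWith G₂ ε` for the same `ε`: the acceptance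
probabilities of the substituted family are those of the original family, being `2⁻ᵗ`-close for
every `t` (`abs_acceptProbOn_substFamily_sub_le`). The case of renamings and embeddings of gate sets.
[cite: NielsenChuang2010, §4.5.3] -/
theorem BQPWith_subset_BQPWith_of_exactCompiler (hG₁ : G₁.IsUnitary) (hG₂ : G₂.IsUnitary)
    (W : GateCompiler G₁ G₂) (hW : W.Sound) (hWu : W.UniformSubst) (hlev : ∀ k g, W.word k g = W.word 0 g)
    (ε : ℝ) : BQPWith G₁ ε ⊆ BQPWith G₂ ε := by
  rintro L ⟨F, hfree, hunif, hacc⟩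
  refine ⟨substFamily W 0 F, isOracleFree_substFamily W hW.isOracleFree 0 hfree,
    hWu.isUniform F 0 hfree hunif, fun x => ?_⟩
  have heq : (substFamily W 0 F).acceptProbOn 0 x = F.acceptProbOn 0 x := by
    by_contra hne
    have hd : 0 < |(substFamily W 0 F).acceptProbOn 0 x - F.acceptProbOn 0 x| :=
      abs_pos.2 (sub_ne_zero.2 hne)
    obtain ⟨t, ht⟩ := exists_pow_lt_of_lt_one hd (by norm_num : (1 / 2 : ℝ) < 1)
    have h := abs_acceptProbOn_substFamily_sub_le W hW hG₁ hG₂ t F 0 x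
    rw [substFamily_eq_of_levelFree W hlev t F] at h
    exact absurd h (not_le.2 ht)
  rw [heq]
  exact hacc x

end Exact

/-! ### Small placement facts -/

section Place

variable {k : ℕ}

/-- Placing along the identity does nothing. [folklore] -/
theorem placeGate_refl (U : Matrix (QReg k) (QReg k) ℂ) : placeGate (Function.Embedding.refl (Fin k)) U = U := by
  ext x y
  rw [placeGate_apply, if_pos]
  · rfl
  · intro i hi
    exact absurd ⟨i, rfl⟩ hi

/-- **A real matrix is realified by idling on the flag wire**: `reOp U = U ⊗ 1` (placement of `U`
on the first wires). [cite: AdlemanDeMarraisHuangSICOMP1997, §2 (p. 1525)] -/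
theorem reOp_eq_placeGate_of_isRealMatrix {U : Matrix (QReg k) (QReg k) ℂ} (hU : IsRealMatrix U) :
    reOp U = placeGate (Fin.castAddEmb 1) U := by
  have h := reOp_placeGate_of_isRealMatrix (Function.Embedding.refl (Fin k)) hU
  rw [placeGate_refl] at h
  rw [h]
  rfl

end Place

/-! ### The real ADH gate set -/

/-- `R_θ` is a real matrix. [cite: AdlemanDeMarraisHuangSICOMP1997, §2 (p. 1526)] -/
theorem isRealMatrix_adhRotGate : IsRealMatrix adhRotGate := by
  intro x y
  rw [adhRotGate, Matrix.of_apply]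
  split_ifs <;> norm_num

/-- `R_θ⁻¹` is a real matrix. [cite: AdlemanDeMarraisHuangSICOMP1997, §2 (p. 1526)] -/
theorem isRealMatrix_adhRotInvGate : IsRealMatrix adhRotInvGate := by
  intro x y
  rw [adhRotInvGate, Matrix.of_apply]
  split_ifs <;> norm_num

/-- **The real ADH gate set** `{R_θ, R_θ⁻¹, Λ(R_θ), Λ(R_θ⁻¹), CNOT}` on `1, 1, 2, 2, 2` wires: the real
rotation and its inverse, the realifications `reOp P_θ^{±1}` of the phase gates — the rotation of the
flag wire (last) by `±θ` controlled by the data wire — and `CNOT`. Same five symbols as `adhGateSet`.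
[cite: AdlemanDeMarraisHuangSICOMP1997, §2 (pp. 1525–1526) and Thm. 3.3(e)] -/
def adhRealGateSet : QGateSet where
  Op := ADHOp
  arity
    | .R => 1
    | .Rinv => 1
    | .P => 2
    | .Pinv => 2
    | .CNOT => 2
  mat
    | .R => adhRotGate
    | .Rinv => adhRotInvGate
    | .P => reOp adhPhaseGate
    | .Pinv => reOp adhPhaseInvGate
    | .CNOT => cnot

/-- The gate alphabet is finite. [folklore] -/
instance : Finite adhRealGateSet.Op := inferInstanceAs (Finite ADHOp)

/-- The gate alphabet is encodable (same codes as `adhGateSet`). [folklore] -/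
instance instEncodableOpAdhRealGateSet : Encodable adhRealGateSet.Op := inferInstanceAs (Encodable ADHOp)

/-- Every real ADH gate acts on at most two wires. [folklore] -/
theorem adhRealGateSet_arity_le_two (g : adhRealGateSet.Op) : adhRealGateSet.arity g ≤ 2 := by
  rcases g with _ | _ | _ | _ | _ <;> decide

/-- Every ADH gate acts on at least one wire. [folklore] -/
theorem adhGateSet_arity_pos (g : adhGateSet.Op) : 0 < adhGateSet.arity g := by
  rcases g with _ | _ | _ | _ | _ <;> decide

/-- **The real ADH gate set is unitary.** [folklore] -/
theorem adhRealGateSet_isUnitary : adhRealGateSet.IsUnitary := by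
  rintro (_ | _ | _ | _ | _)
  · exact adhRotGate_mem_unitaryGroup
  · exact adhRotInvGate_mem_unitaryGroup
  · exact reOp_mem_unitaryGroup adhPhaseGate_mem_unitaryGroup
  · exact reOp_mem_unitaryGroup adhPhaseInvGate_mem_unitaryGroup
  · exact cnot_mem_unitaryGroup_holds

/-- Negated imaginary parts of the ADH entries are ADH amplitudes (`0, ∓4/5`). [cite: AdlemanDeMarraisHuangSICOMP1997, Thm. 3.3(e)] -/
theorem neg_im_mem_adhAmplitudes_of_mem_adhEntries {z : ℂ} (hz : z ∈ adhEntries) :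
    -(((z.im : ℝ) : ℂ)) ∈ adhAmplitudes := by
  simp only [adhEntries, Set.mem_insert_iff, Set.mem_singleton_iff] at hz
  rcases hz with rfl | rfl | rfl | rfl | rfl | rfl | rfl
  · simp [adhAmplitudes]
  · simp [adhAmplitudes]
  · rw [show ((3 : ℂ) / 5).im = 0 by norm_num]
    simp [adhAmplitudes]
  · rw [show ((4 : ℂ) / 5).im = 0 by norm_num]
    simp [adhAmplitudes]
  · rw [show (-((4 : ℂ) / 5)).im = 0 by norm_num]
    simp [adhAmplitudes]
  · rw [adhUnit_im]
    norm_num [adhAmplitudes]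
  · rw [adhUnitInv_im]
    norm_num [adhAmplitudes]

/-- A real entry of an ADH gate is an ADH amplitude. [cite: AdlemanDeMarraisHuangSICOMP1997, Thm. 3.3(e)] -/
theorem mem_adhAmplitudes_of_mem_adhEntries_of_im {z : ℂ} (hz : z ∈ adhEntries) (him : z.im = 0) :
    z ∈ adhAmplitudes := by
  have h : (((z.re : ℝ) : ℂ)) = z := Complex.ext rfl (by simp [him])
  rw [← h]
  exact re_mem_adhAmplitudes_of_mem_adhEntries hz

/-- Entries of the realification of an ADH gate are ADH amplitudes. [cite: AdlemanDeMarraisHuangSICOMP1997, Thm. 3.3(e)] -/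
theorem reOp_adhGateSet_mem_adhAmplitudes (g : ADHOp) (x z : QReg (adhGateSet.arity g + 1)) :
    reOp (adhGateSet.mat g) x z ∈ adhAmplitudes := by
  have hmem := adhGateSet_mat_mem_adhEntries g (Fin.init x) (Fin.init z)
  rcases reOp_apply_mem (adhGateSet.mat g) x z with h | h | h
  · rw [h]
    exact re_mem_adhAmplitudes_of_mem_adhEntries hmem
  · rw [h]
    exact im_mem_adhAmplitudes_of_mem_adhEntries hmem
  · rw [h]
    exact neg_im_mem_adhAmplitudes_of_mem_adhEntries hmem

/-- **Every entry of every real ADH gate is an Adleman–DeMarrais–Huang amplitude** (`0, 1, 3/5, ±4/5`):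
a quantum Turing machine applying these gates verbatim has amplitudes in `adhAmplitudes`.
[cite: AdlemanDeMarraisHuangSICOMP1997, §2 (p. 1526) and Thm. 3.3(e)] -/
theorem adhRealGateSet_mat_mem_adhAmplitudes (g : adhRealGateSet.Op) (x z : QReg (adhRealGateSet.arity g)) :
    adhRealGateSet.mat g x z ∈ adhAmplitudes := by
  rcases g with _ | _ | _ | _ | _
  · exact mem_adhAmplitudes_of_mem_adhEntries_of_im (adhGateSet_mat_mem_adhEntries ADHOp.R x z)
      (isRealMatrix_adhRotGate x z)
  · exact mem_adhAmplitudes_of_mem_adhEntries_of_im (adhGateSet_mat_mem_adhEntries ADHOp.Rinv x z)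
      (isRealMatrix_adhRotInvGate x z)
  · exact reOp_adhGateSet_mem_adhAmplitudes ADHOp.P x z
  · exact reOp_adhGateSet_mem_adhAmplitudes ADHOp.Pinv x z
  · have hc : IsRealMatrix cnot := fun i j => by
      rw [cnot, Matrix.of_apply]
      split_ifs <;> simp
    exact mem_adhAmplitudes_of_mem_adhEntries_of_im (adhGateSet_mat_mem_adhEntries ADHOp.CNOT x z) (hc x z)

/-! ### From the realified gate set to the real one: drop the idle flag wire -/

/-- **The lean-down compiler** from `realifyGateSet adhGateSet` (all five gates widened by the flag
wire) to `adhRealGateSet`: the realified real gates `R_θ^{±1} ⊗ 1`, `CNOT ⊗ 1` become the gates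
themselves on their first wires, the realified phase gates are kept; no scratch wires, words
independent of the level. [folklore] -/
def adhLeanCompiler : GateCompiler (realifyGateSet adhGateSet) adhRealGateSet where
  scratch := 0
  extra _ := 0
  extra_le _ := le_rfl
  word _ g := match g with
    | .R => ⟨[QGate.gate (G := adhRealGateSet) ADHOp.R ((Fin.castAddEmb 1).trans (Fin.castAddEmb 0))]⟩
    | .Rinv => ⟨[QGate.gate (G := adhRealGateSet) ADHOp.Rinv ((Fin.castAddEmb 1).trans (Fin.castAddEmb 0))]⟩
    | .P => ⟨[QGate.gate (G := adhRealGateSet) ADHOp.P (Fin.castAddEmb 0)]⟩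
    | .Pinv => ⟨[QGate.gate (G := adhRealGateSet) ADHOp.Pinv (Fin.castAddEmb 0)]⟩
    | .CNOT => ⟨[QGate.gate (G := adhRealGateSet) ADHOp.CNOT ((Fin.castAddEmb 1).trans (Fin.castAddEmb 0))]⟩

/-- The words do not depend on the level. [folklore] -/
theorem adhLeanCompiler_levelFree (k : ℕ) (g : ADHOp) : adhLeanCompiler.word k g = adhLeanCompiler.word 0 g := by
  cases g <;> rfl

/-- **The lean-down compiler is sound** (indeed exact: every word computes its source gate, phase `1`,
error `0`). [cite: NielsenChuang2010, §4.5.3] -/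
theorem adhLeanCompiler_sound : adhLeanCompiler.Sound where
  isOracleFree k g := by
    cases g <;> (intro γ hγ; obtain rfl := List.mem_singleton.1 hγ; trivial)
  implOn k g := by
    refine ⟨1, norm_one, ?_⟩
    suffices h : (adhLeanCompiler.word k g).toMatrix 0 =
        (1 : ℂ) • placeGate (Fin.castAddEmb (adhLeanCompiler.extra g)) ((realifyGateSet adhGateSet).mat g) by
      rw [h]
      exact (ImplOn.refl _ _).mono (by positivity)
    rw [one_smul]
    cases g with
    | R =>
      change (⟨[QGate.gate (G := adhRealGateSet) ADHOp.R ((Fin.castAddEmb 1).trans (Fin.castAddEmb 0))]⟩ :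
          QCircuit adhRealGateSet (1 + 1 + 0)).toMatrix 0 = placeGate (Fin.castAddEmb 0) (reOp adhRotGate)
      rw [QCircuit.toMatrix_cons, QCircuit.toMatrix_nil, Matrix.one_mul, QGate.toMatrix_gate,
        reOp_eq_placeGate_of_isRealMatrix isRealMatrix_adhRotGate, placeGate_placeGate]
      rfl
    | Rinv =>
      change (⟨[QGate.gate (G := adhRealGateSet) ADHOp.Rinv ((Fin.castAddEmb 1).trans (Fin.castAddEmb 0))]⟩ :
          QCircuit adhRealGateSet (1 + 1 + 0)).toMatrix 0 = placeGate (Fin.castAddEmb 0) (reOp adhRotInvGate)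
      rw [QCircuit.toMatrix_cons, QCircuit.toMatrix_nil, Matrix.one_mul, QGate.toMatrix_gate,
        reOp_eq_placeGate_of_isRealMatrix isRealMatrix_adhRotInvGate, placeGate_placeGate]
      rfl
    | P =>
      change (⟨[QGate.gate (G := adhRealGateSet) ADHOp.P (Fin.castAddEmb 0)]⟩ :
          QCircuit adhRealGateSet (1 + 1 + 0)).toMatrix 0 = placeGate (Fin.castAddEmb 0) (reOp adhPhaseGate)
      rw [QCircuit.toMatrix_cons, QCircuit.toMatrix_nil, Matrix.one_mul, QGate.toMatrix_gate]
      rfl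
    | Pinv =>
      change (⟨[QGate.gate (G := adhRealGateSet) ADHOp.Pinv (Fin.castAddEmb 0)]⟩ :
          QCircuit adhRealGateSet (1 + 1 + 0)).toMatrix 0 = placeGate (Fin.castAddEmb 0) (reOp adhPhaseInvGate)
      rw [QCircuit.toMatrix_cons, QCircuit.toMatrix_nil, Matrix.one_mul, QGate.toMatrix_gate]
      rfl
    | CNOT =>
      change (⟨[QGate.gate (G := adhRealGateSet) ADHOp.CNOT ((Fin.castAddEmb 1).trans (Fin.castAddEmb 0))]⟩ :
          QCircuit adhRealGateSet (2 + 1 + 0)).toMatrix 0 = placeGate (Fin.castAddEmb 0) (reOp cnot)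
      have hc : IsRealMatrix cnot := fun i j => by
        rw [cnot, Matrix.of_apply]
        split_ifs <;> simp
      rw [QCircuit.toMatrix_cons, QCircuit.toMatrix_nil, Matrix.one_mul, QGate.toMatrix_gate,
        reOp_eq_placeGate_of_isRealMatrix hc, placeGate_placeGate]
      rfl

/-- The lean-down compiler is polynomial-time (constant words). [folklore] -/
theorem adhLeanCompiler_polyTime : adhLeanCompiler.PolyTime :=
  ⟨fun g => (CodeFP.const unaryEncodeNat (adhLeanCompiler.word 0 g)).polyTimeComputable⟩

/-- Substitution along the lean-down compiler preserves polynomial-time uniformity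
(`UniformSubstitution.lean`). [cite: NielsenChuang2010, §4.5.3] -/
theorem adhLeanCompiler_uniformSubst : adhLeanCompiler.UniformSubst :=
  adhLeanCompiler.uniformSubst_of_polyTime adhLeanCompiler_polyTime

/-- **Dropping the idle flag wire costs nothing**: `BQPWith (realifyGateSet adhGateSet) ε ⊆ BQPWith adhRealGateSet ε`.
[cite: AdlemanDeMarraisHuangSICOMP1997, §2 (p. 1525)] -/
theorem BQPWith_realify_adhGateSet_subset (ε : ℝ) :
    BQPWith (realifyGateSet adhGateSet) ε ⊆ BQPWith adhRealGateSet ε :=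
  BQPWith_subset_BQPWith_of_exactCompiler (realifyGateSet_isUnitary adhGateSet_isUnitary) adhRealGateSet_isUnitary
    adhLeanCompiler adhLeanCompiler_sound adhLeanCompiler_uniformSubst adhLeanCompiler_levelFree ε

/-! ### `BQP` over the real ADH gate set, and S05 from its executor -/

/-- **`BQPOver adhGateSet ⊆ BQPOver adhRealGateSet`** (realify with one flag wire, then drop the idle
flag wire of the real gates). [cite: AdlemanDeMarraisHuangSICOMP1997, §2 (p. 1525)] -/
theorem BQPOver_adhGateSet_subset_adhRealGateSet : BQPOver adhGateSet ⊆ BQPOver adhRealGateSet :=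
  (BQPOver_subset_BQPOver_realify adhGateSet adhGateSet_arity_pos).trans (BQPWith_realify_adhGateSet_subset (1 / 3))

/-- **`BQP ⊆ BQPOver adhRealGateSet`**: every `BQP` language is decided, with error `≤ 1/3`, by a
polynomial-time uniform family of circuits whose gates are real matrices on at most two wires with
entries in `{0, ±3/5, ±4/5, ±1}` (Solovay–Kitaev compilation into `{R_θ^{±1}, P_θ^{±1}, CNOT}`,
`BQPOver_adhGateSet_eq_BQP`, then realification). The circuit form of Adleman–DeMarrais–Huang's
Cor. 3.2 / Thm. 3.3(e). [cite: AdlemanDeMarraisHuangSICOMP1997, Cor. 3.2 with Thm. 3.3(e)] -/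
theorem BQP_subset_BQPOver_adhRealGateSet : BQP ⊆ BQPOver adhRealGateSet := by
  rw [← BQPOver_adhGateSet_eq_BQP]
  exact BQPOver_adhGateSet_subset_adhRealGateSet

/-- `BQPQTM ⊆ BQPOver adhRealGateSet`. [cite: AdlemanDeMarraisHuangSICOMP1997, Cor. 3.2] -/
theorem BQPQTM_subset_BQPOver_adhRealGateSet : BQPQTM ⊆ BQPOver adhRealGateSet :=
  BQPQTM_subset_BQP.trans BQP_subset_BQPOver_adhRealGateSet

/-- **The missing inclusion of S05 from the circuit executor over the REAL ADH gate set.** If every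
language decided by a polynomial-time uniform family of circuits over `adhRealGateSet` (real gates on
`≤ 2` wires with entries in `{0, 1, 3/5, ±4/5}`) is decided, in the sense of `BQPQTMWith`, by a
well-formed quantum Turing machine with amplitudes in `{0, ±3/5, ±4/5, ±1}` (the executor of
Nishimura–Ozawa 2002, Lemma 4.4, whose quantum transitions are the gate entries and whose classical
transitions have amplitudes `0, 1`), then `BQPQTM ⊆ BQPQTMWith adhAmplitudes`. Together with the proved
inclusion `BQPQTMWith_adhAmplitudes_subset_BQPQTM` this is exactly the named fact
`BQPQTMWith_adhAmplitudes : BQPQTMWith adhAmplitudes = BQPQTM` (by `Set.Subset.antisymm`); it is stated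
as the missing inclusion, a conditional reduction, so that no theorem of this file carries the type of
the open fact (D-0026 (ii)). [cite: AdlemanDeMarraisHuangSICOMP1997, Thm. 3.1 and Cor. 3.2 with Thm. 3.3(e)] -/
theorem BQPQTM_subset_BQPQTMWith_adhAmplitudes_of_realExec
    (hExec : BQPOver adhRealGateSet ⊆ BQPQTMWith adhAmplitudes) : BQPQTM ⊆ BQPQTMWith adhAmplitudes :=
  BQPQTM_subset_BQPOver_adhRealGateSet.trans hExec

end Literature.Computability.QuantumComplexity

end
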